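import Summits.QuantumAdvantage.QuantumAdvantage.Theorems.WalkFiniteStateChecker

/-!
# `NoPerfectFinState2 5 12` — the SHARP threshold (planner qa-qnc0-p2 g21, ROUND-21 §6 (H); ask P2-21 (e);
# `--supports` crux `ManyReadersSqrtOdd` stmt-QuantumAdvantage-23109)

Prover seat qn-prover-3 g14.  **`noPerfectFinState2_12 : Coset21.NoPerfectFinState2 5 12`**: for every ring length `n ≥ 12`,
every charge `c` and every 2-step finite-state strategy modulo `5` (`FinState2 5 y`), some input loses the u-walk game.
SHARP: the planner's exact computation (`line21/perfect_fs2.py`, ROUND-21 §6 (H)) exhibits perfect strategies at `n = 10, 11`.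

Assembly: `n ≥ 38` is the computation-free tail `noPerfectFinState2_38` (`WalkFiniteStateNoPerfect.lean`); for `12 ≤ n ≤ 37` the
refuter `fullCheck n (c % 3) 1` of `WalkFiniteStateChecker.lean` (weight class `W ≡ 1 (mod 5)`, which works uniformly for all
`78` pairs `(n, c mod 3)`) is evaluated by the kernel (`decide +kernel`, standard axioms; ≈ 1.5 s per pair on the farm, split in
three ranges) and its soundness theorem `exists_loser_of_fullCheck` converts each `true` into a losing input.

WHAT THIS IS NOT: nothing about polynomial strategies, `LinSel`, or the rung `TwoStepFiniteStateWalkHard`; separation NOT moved.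
-/

namespace Summit.QuantumAdvantage.AdviceFreeQNC0

namespace Coset21

/-- The refuter passes for `12 ≤ n ≤ 21`, all charges, class `1` (kernel evaluation). -/
theorem fullCheck_12_21 : ∀ n, 12 ≤ n → n < 22 → ∀ c < 3, fullCheck n c 1 = true := by
  decide +kernel

/-- The refuter passes for `22 ≤ n ≤ 30`, all charges, class `1` (kernel evaluation). -/
theorem fullCheck_22_30 : ∀ n, 22 ≤ n → n < 31 → ∀ c < 3, fullCheck n c 1 = true := by
  decide +kernel

/-- The refuter passes for `31 ≤ n ≤ 37`, all charges, class `1` (kernel evaluation). -/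
theorem fullCheck_31_37 : ∀ n, 31 ≤ n → n < 38 → ∀ c < 3, fullCheck n c 1 = true := by
  decide +kernel

/-- The refuter passes on the whole range `12 ≤ n ≤ 37`. -/
theorem fullCheck_range {n : ℕ} (h12 : 12 ≤ n) (h37 : n < 38) (c : ℕ) (hc : c < 3) : fullCheck n c 1 = true := by
  by_cases h1 : n < 22
  · exact fullCheck_12_21 n h12 h1 c hc
  · by_cases h2 : n < 31
    · exact fullCheck_22_30 n (by omega) h2 c hc
    · exact fullCheck_31_37 n (by omega) h37 c hc

/-- **`NoPerfectFinState2 5 12`** (ROUND-21 §6 (H), sharp threshold): no 2-step finite-state strategy modulo `5` wins the u-walk game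
on every input once `n ≥ 12`, at any charge. -/
theorem noPerfectFinState2_12 : NoPerfectFinState2 5 12 := by
  intro n hn c y hy
  by_cases h38 : 38 ≤ n
  · exact noPerfectFinState2_38 n h38 c y hy
  · exact exists_loser_of_fullCheck (by omega) c (w := 1) (by norm_num)
      (fullCheck_range hn (by omega) (c % 3) (Nat.mod_lt c (by norm_num))) y hy

end Coset21

end Summit.QuantumAdvantage.AdviceFreeQNC0
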